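import Literature.NumberTheory.EllipticCurves.ZpExtensionScalarTwist
import HarnessLib

/-!
# Morphisms of the twisted modules `M ⊗ 𝒪(χ_u)` and of Howard's `T_𝔮/p^k T_𝔮`: the coefficient action as
# Galois endomorphisms, functoriality in `M`, and the reduction maps `T_𝔮/p^{k'} → T_𝔮/p^k`
# (definitions with bodies + unfolding lemmas; no named fact, no instance, no notation)

Topic `NumberTheory/EllipticCurves` (companion of `ZpExtensionScalarTwist`). Everything here is a continuous
intertwining map (Mathlib `ContIntertwiningMap`, notation `→ⁱL`) between the `ContRepresentation`s underlying the
discrete Galois modules of `ZpExtensionScalarTwist`, i.e. exactly the input of the tree's functoriality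
`galoisCohomology.map` (file `GaloisRepresentations/GaloisCohomology`):

* §1 `DiscreteGaloisModule.coeffExtensionSMulHom 𝒪 ρ c` — multiplication by `c ∈ 𝒪` on `𝒪 ⊗_ℤ M` commutes
  with `Γ_K` (`coeffExtension_apply_smul`), hence is an endomorphism of the discrete Galois module
  `coeffExtension 𝒪 ρ`; `DiscreteGaloisModule.coeffExtensionMap 𝒪 f` — `1 ⊗ f` for a morphism `f : M → M'`
  of discrete Galois modules.
* §2 `ZpExtension.scalarTwistSMulHom` — the same for the scalar twist `N(χ_u)` (`scalarTwist_apply_smul`);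
  `ZpExtension.scalarTwistMap` — an `𝒪`-linear morphism `f : N → N'` of discrete Galois modules is a morphism of
  the twists `N(χ_u) → N'(χ_u)`; `ZpExtension.pow_twistExponent_eq_of_pow_eq_one` — the twisting unit
  `u^{κ(σ) mod p^J}` does not depend on the admissible level `J`.
* §3 for Howard's modules `M ⊗ A_{m,k}(ψ)` (`ZpExtension.eisensteinTwist`):
  `ZpExtension.eisensteinTwistSMulHom κ ρ hm k c` (so that `H^n(K, M ⊗ A_{m,k}(ψ))` is an `A_{m,k}`-, `S_𝔮`- and
  `Λ`-module through `galoisCohomology.map`), `ZpExtension.eisensteinTwistMap κ hm k f` (functoriality in `M`),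
  and the **reduction maps** `ZpExtension.eisensteinTwistReduce κ hm hkk' f :
  M ⊗ A_{m,k'}(ψ) → M' ⊗ A_{m,k}(ψ)` for `k ≤ k'` along the change of rings `A_{m,k'} ↠ A_{m,k}`
  (`IwasawaAlgebra.EisensteinCoeff.reduce`, Mathlib `Ideal.Quotient.lift`) and a morphism `f : M → M'` — for
  `M = E[p^{k'}] → M' = E[p^k]`, `P ↦ p^{k'-k} P` (the tree's `WeierstrassCurve.torsionMulBy`) this is the
  transition map `T_𝔮/p^{k'} T_𝔮 → T_𝔮/p^k T_𝔮` of the inverse system whose limit is `T_𝔮`, i.e. the maps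
  along which `H¹(K, T_𝔮) = lim_k H¹(K, T_𝔮/p^k)` is formed [Howard 2004, §2.2, Lemma 2.2.7 / Prop. 2.2.8
  (control at `𝔮`); Mazur–Rubin 2004, §5.3].

Cell `pub/bsd-print-x9`, D1 road of the shared μ-residual of rows 9/10 (memo PORT-ALGEBRA-LAYER §5: carrier ✓
`ZpExtensionScalarTwist`; this file = the maps a pinned `H = lim_k H¹_{F_𝔮}(K, T_𝔮/p^k)` needs; Selmer
structure `F_𝔮` and control maps not here). BSD is not proved by any of this.

References: [Howard2004HeegnerKolyvagin] B. Howard, Compositio Math. 140 (2004), §2.2, Def. 2.2.3, Lemma 2.2.7,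
Prop. 2.2.8, proof of Thm. 2.2.10; [MazurRubinMemoirs2004] B. Mazur, K. Rubin, Mem. AMS 799 (2004), §5.3;
[SerreGaloisCohomology1997] I §2.1–§2.2 (functoriality of cohomology of discrete modules).
-/

noncomputable section

open scoped TensorProduct Topology ContRepresentation
open Field Filter

universe u v w

namespace Literature.NumberTheory.EllipticCurves

open Literature.NumberTheory.GaloisRepresentations

/-! ## §1 Maps of `𝒪 ⊗_ℤ M` -/

namespace DiscreteGaloisModule

variable {K : Type u} [Field K] (𝒪 : Type v) [CommRing 𝒪] {M : Type w} [AddCommGroup M]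
  [TopologicalSpace M] [DiscreteTopology M] {M' : Type w} [AddCommGroup M'] [TopologicalSpace M']
  [DiscreteTopology M']

/-- **Multiplication by `c ∈ 𝒪` is an endomorphism of the discrete Galois module `𝒪 ⊗_ℤ M`** (it commutes
with `σ ↦ 1 ⊗ ρ(σ)`, `coeffExtension_apply_smul`), as a continuous intertwining map — the input of
`galoisCohomology.map`, through which `H^n(K, 𝒪 ⊗ M)` becomes an `𝒪`-module.
[cite: Howard2004HeegnerKolyvagin, §2.2 (T_𝔮 is an S_𝔮[Γ_K]-module)] [cite: SerreGaloisCohomology1997, I §2.2] -/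
def coeffExtensionSMulHom (ρ : DiscreteGaloisModule K M) (c : 𝒪) :
    (coeffExtension 𝒪 ρ).toContRepresentation →ⁱL (coeffExtension 𝒪 ρ).toContRepresentation where
  toContinuousLinearMap :=
    ⟨(DistribSMul.toAddMonoidHom (CoeffExtension ℤ 𝒪 M) c).toIntLinearMap, continuous_of_discreteTopology⟩
  isIntertwining' σ := by
    ext x
    exact (coeffExtension_apply_smul 𝒪 ρ σ c x).symm

/-- Unfolding `coeffExtensionSMulHom`: it is `x ↦ c • x`. [cite: Howard2004HeegnerKolyvagin, §2.2] -/
@[simp]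
theorem coeffExtensionSMulHom_apply (ρ : DiscreteGaloisModule K M) (c : 𝒪) (x : CoeffExtension ℤ 𝒪 M) :
    coeffExtensionSMulHom 𝒪 ρ c x = c • x :=
  rfl

omit [TopologicalSpace M] [DiscreteTopology M] [TopologicalSpace M'] [DiscreteTopology M'] in
/-- `1 ⊗ f : 𝒪 ⊗ M → 𝒪 ⊗ M'` for an additive (`ℤ`-linear) `f : M → M'`, on the tree's carriers
(Mathlib `LinearMap.lTensor`). [cite: Howard2004HeegnerKolyvagin, §2.2] -/
def coeffExtensionLinear (f : M →ₗ[ℤ] M') : CoeffExtension ℤ 𝒪 M →ₗ[ℤ] CoeffExtension ℤ 𝒪 M' :=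
  (f.lTensor 𝒪 : 𝒪 ⊗[ℤ] M →ₗ[ℤ] 𝒪 ⊗[ℤ] M')

omit [TopologicalSpace M] [DiscreteTopology M] [TopologicalSpace M'] [DiscreteTopology M'] in
/-- `coeffExtensionLinear` on pure tensors: `(1 ⊗ f)(c ⊗ a) = c ⊗ f a`. [cite: Howard2004HeegnerKolyvagin, §2.2] -/
@[simp]
theorem coeffExtensionLinear_tmul (f : M →ₗ[ℤ] M') (c : 𝒪) (a : M) :
    coeffExtensionLinear 𝒪 f (CoeffExtension.tmul c a) = CoeffExtension.tmul c (f a) :=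
  LinearMap.lTensor_tmul _ _ _ _

omit [TopologicalSpace M] [DiscreteTopology M] [TopologicalSpace M'] [DiscreteTopology M'] in
/-- `1 ⊗ f` is `𝒪`-linear. [cite: Howard2004HeegnerKolyvagin, §2.2] -/
theorem coeffExtensionLinear_smul (f : M →ₗ[ℤ] M') (c : 𝒪) (x : CoeffExtension ℤ 𝒪 M) :
    coeffExtensionLinear 𝒪 f (c • x) = c • coeffExtensionLinear 𝒪 f x := by
  have h := (f.baseChange 𝒪).map_smul c (x : 𝒪 ⊗[ℤ] M)
  rw [LinearMap.baseChange_eq_ltensor] at h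
  exact h

/-- **Functoriality of `𝒪 ⊗_ℤ (·)` in the module**: a morphism `f : M → M'` of discrete Galois modules induces
`1 ⊗ f : 𝒪 ⊗ M → 𝒪 ⊗ M'`, again a morphism. [cite: Howard2004HeegnerKolyvagin, §2.2] [cite: SerreGaloisCohomology1997, I §2.2] -/
def coeffExtensionMap {ρ : DiscreteGaloisModule K M} {ρ' : DiscreteGaloisModule K M'}
    (f : ρ.toContRepresentation →ⁱL ρ'.toContRepresentation) :
    (coeffExtension 𝒪 ρ).toContRepresentation →ⁱL (coeffExtension 𝒪 ρ').toContRepresentation where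
  toContinuousLinearMap :=
    ⟨coeffExtensionLinear 𝒪 f.toContinuousLinearMap.toLinearMap, continuous_of_discreteTopology⟩
  isIntertwining' σ := by
    ext x
    change coeffExtensionLinear 𝒪 f.toContinuousLinearMap.toLinearMap (coeffExtension 𝒪 ρ σ x) =
      coeffExtension 𝒪 ρ' σ (coeffExtensionLinear 𝒪 f.toContinuousLinearMap.toLinearMap x)
    induction x using CoeffExtension.induction_on with
    | zero => simp only [map_zero]
    | tmul c a =>
      rw [coeffExtension_apply_tmul, coeffExtensionLinear_tmul, coeffExtensionLinear_tmul,
        coeffExtension_apply_tmul]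
      congr 1
      exact congrArg (fun g ↦ g a) (f.isIntertwining' σ)
    | add x y hx hy => rw [map_add, map_add, hx, hy, map_add, map_add]

/-- Unfolding `coeffExtensionMap` on pure tensors: `(1 ⊗ f)(c ⊗ a) = c ⊗ f a`. [cite: Howard2004HeegnerKolyvagin, §2.2] -/
@[simp]
theorem coeffExtensionMap_tmul {ρ : DiscreteGaloisModule K M} {ρ' : DiscreteGaloisModule K M'}
    (f : ρ.toContRepresentation →ⁱL ρ'.toContRepresentation) (c : 𝒪) (a : M) :
    coeffExtensionMap 𝒪 f (CoeffExtension.tmul c a) = CoeffExtension.tmul c (f a) :=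
  coeffExtensionLinear_tmul 𝒪 _ c a

/-- `1 ⊗ f` is `𝒪`-linear. [cite: Howard2004HeegnerKolyvagin, §2.2] -/
theorem coeffExtensionMap_smul {ρ : DiscreteGaloisModule K M} {ρ' : DiscreteGaloisModule K M'}
    (f : ρ.toContRepresentation →ⁱL ρ'.toContRepresentation) (c : 𝒪) (x : CoeffExtension ℤ 𝒪 M) :
    coeffExtensionMap 𝒪 f (c • x) = c • coeffExtensionMap 𝒪 f x :=
  coeffExtensionLinear_smul 𝒪 _ c x

end DiscreteGaloisModule

/-! ## §2 Maps of the scalar twist `N(χ_u)` -/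

namespace ZpExtension

variable {K : Type u} [Field K] {p : ℕ} [Fact p.Prime] (κ : ZpExtension K p)
  {𝒪 : Type v} [CommRing 𝒪] {N : Type w} [AddCommGroup N] [Module 𝒪 N] [TopologicalSpace N]
  [DiscreteTopology N] {N' : Type w} [AddCommGroup N'] [Module 𝒪 N'] [TopologicalSpace N']
  [DiscreteTopology N']

omit [TopologicalSpace N] [DiscreteTopology N] in
/-- **The twisting unit does not depend on the admissible level**: if `u^{p^J} = 1` and `u^{p^{J'}} = 1` in `𝒪`
then `u^{κ(σ) mod p^J} = u^{κ(σ) mod p^{J'}}` (the exponents agree modulo `p^{min(J,J')}`).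
[cite: Washington1997, §13.1–§13.2] -/
theorem pow_twistExponent_eq_of_pow_eq_one {u : 𝒪} {J J' : ℕ} (hJ : u ^ (p ^ J) = 1)
    (hJ' : u ^ (p ^ J') = 1) (σ : absoluteGaloisGroup K) :
    u ^ κ.twistExponent J σ = u ^ κ.twistExponent J' σ := by
  have key : ∀ {J J' : ℕ}, J ≤ J' → u ^ (p ^ J) = 1 → u ^ κ.twistExponent J σ = u ^ κ.twistExponent J' σ := by
    intro J J' hle h1
    rw [← κ.twistExponent_mod_pow J' hle σ]
    conv_rhs => rw [← Nat.mod_add_div (κ.twistExponent J' σ) (p ^ J), pow_add, pow_mul, h1, one_pow, mul_one]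
  rcases le_total J J' with h | h
  · exact key h hJ
  · exact (key h hJ').symm

variable (ρ : DiscreteGaloisModule K N)
  (hlin : ∀ (σ : absoluteGaloisGroup K) (c : 𝒪) (x : N), ρ σ (c • x) = c • ρ σ x) (J : ℕ) (u : 𝒪)
  (hu : ∀ x : N, u ^ (p ^ J) • x = x)

/-- **Multiplication by `c ∈ 𝒪` is an endomorphism of the twist `N(χ_u)`** (`scalarTwist_apply_smul`), as a
continuous intertwining map. [cite: Howard2004HeegnerKolyvagin, §2.2 (T_𝔮 is an S_𝔮[Γ_K]-module)]
[cite: SerreGaloisCohomology1997, I §2.2] -/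
def scalarTwistSMulHom (c : 𝒪) :
    (κ.scalarTwist ρ hlin J u hu).toContRepresentation →ⁱL (κ.scalarTwist ρ hlin J u hu).toContRepresentation where
  toContinuousLinearMap := ⟨(DistribSMul.toAddMonoidHom N c).toIntLinearMap, continuous_of_discreteTopology⟩
  isIntertwining' σ := by
    ext x
    exact (κ.scalarTwist_apply_smul ρ hlin J u hu σ c x).symm

/-- Unfolding `scalarTwistSMulHom`: it is `x ↦ c • x`. [cite: Howard2004HeegnerKolyvagin, §2.2] -/
@[simp]
theorem scalarTwistSMulHom_apply (c : 𝒪) (x : N) : κ.scalarTwistSMulHom ρ hlin J u hu c x = c • x := rfl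

variable (ρ' : DiscreteGaloisModule K N')
  (hlin' : ∀ (σ : absoluteGaloisGroup K) (c : 𝒪) (x : N'), ρ' σ (c • x) = c • ρ' σ x)
  (hu' : ∀ x : N', u ^ (p ^ J) • x = x)

/-- **Functoriality of the scalar twist**: an `𝒪`-linear morphism `f : N → N'` of discrete Galois modules is a
morphism `N(χ_u) → N'(χ_u)` of the twists (same underlying map). [cite: GreenbergLNM1716, §4 p. 105]
[cite: Howard2004HeegnerKolyvagin, §2.2] -/
def scalarTwistMap (f : ρ.toContRepresentation →ⁱL ρ'.toContRepresentation)
    (hf : ∀ (c : 𝒪) (x : N), f (c • x) = c • f x) :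
    (κ.scalarTwist ρ hlin J u hu).toContRepresentation →ⁱL
      (κ.scalarTwist ρ' hlin' J u hu').toContRepresentation where
  toContinuousLinearMap := f.toContinuousLinearMap
  isIntertwining' σ := by
    ext x
    change f (κ.scalarTwist ρ hlin J u hu σ x) = κ.scalarTwist ρ' hlin' J u hu' σ (f x)
    rw [scalarTwist_apply_apply, scalarTwist_apply_apply, hf]
    congr 1
    exact congrArg (fun g ↦ g x) (f.isIntertwining' σ)

/-- Unfolding `scalarTwistMap`: it is `f`. [cite: Howard2004HeegnerKolyvagin, §2.2] -/
@[simp]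
theorem scalarTwistMap_apply (f : ρ.toContRepresentation →ⁱL ρ'.toContRepresentation)
    (hf : ∀ (c : 𝒪) (x : N), f (c • x) = c • f x) (x : N) :
    κ.scalarTwistMap ρ hlin J u hu ρ' hlin' hu' f hf x = f x :=
  rfl

end ZpExtension

/-! ## §3 Maps of Howard's modules `M ⊗ A_{m,k}(ψ)` -/

namespace IwasawaAlgebra.EisensteinCoeff

variable {p : ℕ} [hp : Fact p.Prime]

/-- The ideal `(q_m, p^{k'})` is contained in `(q_m, p^k)` for `k ≤ k'`. [cite: Howard2004HeegnerKolyvagin, §2.2] -/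
theorem ideal_le_of_le (m : ℕ) {k k' : ℕ} (hkk' : k ≤ k') :
    Ideal.span {(PowerSeries.X ^ m + PowerSeries.C (p : ℤ_[p]) : IwasawaAlgebra p)} ⊔
        Ideal.span {PowerSeries.C ((p : ℤ_[p]) ^ k')} ≤
      Ideal.span {(PowerSeries.X ^ m + PowerSeries.C (p : ℤ_[p]) : IwasawaAlgebra p)} ⊔
        Ideal.span {PowerSeries.C ((p : ℤ_[p]) ^ k)} := by
  refine sup_le le_sup_left ((Ideal.span_singleton_le_iff_mem _).mpr (Ideal.mem_sup_right ?_))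
  rw [Ideal.mem_span_singleton]
  exact ⟨PowerSeries.C ((p : ℤ_[p]) ^ (k' - k)), by rw [← map_mul, ← pow_add, Nat.add_sub_cancel' hkk']⟩

variable (p) in
/-- **The change of rings `A_{m,k'} ↠ A_{m,k}`** (`k ≤ k'`; Mathlib `Ideal.Quotient.lift` of the projection), along which
`T_𝔮/p^{k'} → T_𝔮/p^k`. [cite: Howard2004HeegnerKolyvagin, §2.2] -/
def reduce (m : ℕ) {k k' : ℕ} (hkk' : k ≤ k') : EisensteinCoeff p m k' →+* EisensteinCoeff p m k :=
  Ideal.Quotient.lift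
    (Ideal.span {(PowerSeries.X ^ m + PowerSeries.C (p : ℤ_[p]) : IwasawaAlgebra p)} ⊔
      Ideal.span {PowerSeries.C ((p : ℤ_[p]) ^ k')})
    (Ideal.Quotient.mk (Ideal.span {(PowerSeries.X ^ m + PowerSeries.C (p : ℤ_[p]) : IwasawaAlgebra p)} ⊔
      Ideal.span {PowerSeries.C ((p : ℤ_[p]) ^ k)}))
    fun _ ha ↦ Ideal.Quotient.eq_zero_iff_mem.mpr (ideal_le_of_le (p := p) m hkk' ha)

/-- `reduce` on classes: `reduce [f] = [f]`. [cite: Howard2004HeegnerKolyvagin, §2.2] -/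
@[simp]
theorem reduce_mk (m : ℕ) {k k' : ℕ} (hkk' : k ≤ k') (f : IwasawaAlgebra p) :
    reduce p m hkk' (Ideal.Quotient.mk _ f) = Ideal.Quotient.mk _ f :=
  Ideal.Quotient.lift_mk _ _ _

/-- `reduce (1 + T) = 1 + T`. [cite: Howard2004HeegnerKolyvagin, §2.2] -/
@[simp]
theorem reduce_onePlusT (m : ℕ) {k k' : ℕ} (hkk' : k ≤ k') :
    reduce p m hkk' (onePlusT p m k') = onePlusT p m k :=
  reduce_mk m hkk' _

/-- `reduce` is surjective. [cite: Howard2004HeegnerKolyvagin, §2.2] -/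
theorem reduce_surjective (m : ℕ) {k k' : ℕ} (hkk' : k ≤ k') : Function.Surjective (reduce p m hkk') := by
  intro y
  obtain ⟨g, rfl⟩ := Ideal.Quotient.mk_surjective y
  exact ⟨Ideal.Quotient.mk _ g, reduce_mk m hkk' g⟩

end IwasawaAlgebra.EisensteinCoeff

namespace ZpExtension

variable {K : Type u} [Field K] {p : ℕ} [hp : Fact p.Prime] (κ : ZpExtension K p)
  {M : Type w} [AddCommGroup M] [TopologicalSpace M] [DiscreteTopology M]
  {M' : Type w} [AddCommGroup M'] [TopologicalSpace M'] [DiscreteTopology M']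
  (ρ : DiscreteGaloisModule K M) {m : ℕ} (hm : 1 ≤ m) (k : ℕ)

/-- **Multiplication by `c ∈ A_{m,k}` is an endomorphism of `M ⊗ A_{m,k}(ψ)`** (`eisensteinTwist_apply_smul`),
as a continuous intertwining map: through `galoisCohomology.map` the groups `H^n(K, M ⊗ A_{m,k}(ψ))` — for
`M = E[p^k]`, `H^n(K, T_𝔮/p^k T_𝔮)` — are `A_{m,k}`-modules, hence `S_𝔮 = Λ/𝔮`- and `Λ`-modules.
[cite: Howard2004HeegnerKolyvagin, §2.2 and Def. 2.2.3 (H¹(K, T_𝔮) as an S_𝔮-module)] -/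
def eisensteinTwistSMulHom (c : IwasawaAlgebra.EisensteinCoeff p m k) :
    (κ.eisensteinTwist ρ hm k).toContRepresentation →ⁱL (κ.eisensteinTwist ρ hm k).toContRepresentation where
  toContinuousLinearMap :=
    ⟨(DistribSMul.toAddMonoidHom (IwasawaAlgebra.EisensteinCoeff.Twisted p m k M) c).toIntLinearMap,
      continuous_of_discreteTopology⟩
  isIntertwining' σ := by
    ext x
    exact (κ.eisensteinTwist_apply_smul ρ hm k σ c x).symm

/-- Unfolding `eisensteinTwistSMulHom`: it is `x ↦ c • x`. [cite: Howard2004HeegnerKolyvagin, §2.2] -/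
@[simp]
theorem eisensteinTwistSMulHom_apply (c : IwasawaAlgebra.EisensteinCoeff p m k)
    (x : IwasawaAlgebra.EisensteinCoeff.Twisted p m k M) : κ.eisensteinTwistSMulHom ρ hm k c x = c • x :=
  rfl

/-- The `Λ`-action on `M ⊗ A_{m,k}(ψ)` through `Λ ↠ A_{m,k}`: the endomorphism attached to `f ∈ Λ` is
multiplication by the class of `f` (so `T` acts through `1 + T ↤ γ`, and `q_m`, `p^k` act by `0`).
[cite: Howard2004HeegnerKolyvagin, §2.2 (T_𝔮 = 𝐓 ⊗_Λ S_𝔮)] -/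
theorem eisensteinTwistSMulHom_mk_apply (f : IwasawaAlgebra p) (x : IwasawaAlgebra.EisensteinCoeff.Twisted p m k M) :
    κ.eisensteinTwistSMulHom ρ hm k (Ideal.Quotient.mk _ f) x =
      (Ideal.Quotient.mk _ f : IwasawaAlgebra.EisensteinCoeff p m k) • x :=
  rfl

/-- `q_m = T^m + p` acts by zero on `M ⊗ A_{m,k}(ψ)`. [cite: Howard2004HeegnerKolyvagin, §2.2 (T_𝔮 is killed by 𝔮)] -/
theorem eisensteinTwistSMulHom_qm (x : IwasawaAlgebra.EisensteinCoeff.Twisted p m k M) :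
    κ.eisensteinTwistSMulHom ρ hm k
      (Ideal.Quotient.mk _ (PowerSeries.X ^ m + PowerSeries.C (p : ℤ_[p]) : IwasawaAlgebra p)) x = 0 := by
  rw [eisensteinTwistSMulHom_apply,
    Ideal.Quotient.eq_zero_iff_mem.mpr (Ideal.mem_sup_left (Ideal.mem_span_singleton_self _)), zero_smul]

variable {ρ} {ρ' : DiscreteGaloisModule K M'}

/-- **Functoriality of `M ⊗ A_{m,k}(ψ)` in `M`**: a morphism `f : M → M'` of discrete Galois modules induces
`f ⊗ 1 : M ⊗ A_{m,k}(ψ) → M' ⊗ A_{m,k}(ψ)`, a morphism of the twisted modules.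
[cite: Howard2004HeegnerKolyvagin, §2.2] [cite: SerreGaloisCohomology1997, I §2.2] -/
def eisensteinTwistMap (f : ρ.toContRepresentation →ⁱL ρ'.toContRepresentation) :
    (κ.eisensteinTwist ρ hm k).toContRepresentation →ⁱL (κ.eisensteinTwist ρ' hm k).toContRepresentation :=
  κ.scalarTwistMap _ _ _ _ _ _ _ _ (DiscreteGaloisModule.coeffExtensionMap (IwasawaAlgebra.EisensteinCoeff p m k) f)
    (DiscreteGaloisModule.coeffExtensionMap_smul (IwasawaAlgebra.EisensteinCoeff p m k) f)

/-- Unfolding `eisensteinTwistMap` on pure tensors: `(f ⊗ 1)(c ⊗ a) = c ⊗ f a`. [cite: Howard2004HeegnerKolyvagin, §2.2] -/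
@[simp]
theorem eisensteinTwistMap_tmul (f : ρ.toContRepresentation →ⁱL ρ'.toContRepresentation)
    (c : IwasawaAlgebra.EisensteinCoeff p m k) (a : M) :
    κ.eisensteinTwistMap hm k f (IwasawaAlgebra.EisensteinCoeff.Twisted.tmul c a) =
      IwasawaAlgebra.EisensteinCoeff.Twisted.tmul c (f a) :=
  DiscreteGaloisModule.coeffExtensionMap_tmul _ f c a

/-- `f ⊗ 1` is `A_{m,k}`-linear. [cite: Howard2004HeegnerKolyvagin, §2.2] -/
theorem eisensteinTwistMap_smul (f : ρ.toContRepresentation →ⁱL ρ'.toContRepresentation)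
    (c : IwasawaAlgebra.EisensteinCoeff p m k) (x : IwasawaAlgebra.EisensteinCoeff.Twisted p m k M) :
    κ.eisensteinTwistMap hm k f (c • x) = c • κ.eisensteinTwistMap hm k f x :=
  DiscreteGaloisModule.coeffExtensionMap_smul _ f c x

/-! ### The reduction maps `M ⊗ A_{m,k'}(ψ) → M' ⊗ A_{m,k}(ψ)`, `k ≤ k'` -/

variable {k} {k' : ℕ} (hkk' : k ≤ k')

/-- The underlying additive map of the reduction: `c ⊗ a ↦ (c mod (q_m, p^k)) ⊗ f a` (Mathlib
`TensorProduct.map` of the ring change `A_{m,k'} ↠ A_{m,k}` and `f`). [cite: Howard2004HeegnerKolyvagin, §2.2] -/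
def eisensteinTwistReduceLinear (f : M →ₗ[ℤ] M') :
    IwasawaAlgebra.EisensteinCoeff.Twisted p m k' M →ₗ[ℤ] IwasawaAlgebra.EisensteinCoeff.Twisted p m k M' :=
  (TensorProduct.map (IwasawaAlgebra.EisensteinCoeff.reduce p m hkk').toAddMonoidHom.toIntLinearMap f :
    IwasawaAlgebra.EisensteinCoeff p m k' ⊗[ℤ] M →ₗ[ℤ] IwasawaAlgebra.EisensteinCoeff p m k ⊗[ℤ] M')

omit [TopologicalSpace M] [DiscreteTopology M] [TopologicalSpace M'] [DiscreteTopology M'] in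
/-- `eisensteinTwistReduceLinear` on pure tensors. [cite: Howard2004HeegnerKolyvagin, §2.2] -/
@[simp]
theorem eisensteinTwistReduceLinear_tmul (f : M →ₗ[ℤ] M') (c : IwasawaAlgebra.EisensteinCoeff p m k') (a : M) :
    eisensteinTwistReduceLinear (p := p) hkk' f (IwasawaAlgebra.EisensteinCoeff.Twisted.tmul c a) =
      IwasawaAlgebra.EisensteinCoeff.Twisted.tmul (IwasawaAlgebra.EisensteinCoeff.reduce p m hkk' c) (f a) :=
  TensorProduct.map_tmul _ _ _ _

omit [TopologicalSpace M] [DiscreteTopology M] [TopologicalSpace M'] [DiscreteTopology M'] in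
/-- `eisensteinTwistReduceLinear` is semilinear along `A_{m,k'} ↠ A_{m,k}`: `r(c • x) = (c mod) • r(x)`.
[cite: Howard2004HeegnerKolyvagin, §2.2] -/
theorem eisensteinTwistReduceLinear_smul (f : M →ₗ[ℤ] M') (c : IwasawaAlgebra.EisensteinCoeff p m k')
    (x : IwasawaAlgebra.EisensteinCoeff.Twisted p m k' M) :
    eisensteinTwistReduceLinear (p := p) hkk' f (c • x) =
      IwasawaAlgebra.EisensteinCoeff.reduce p m hkk' c • eisensteinTwistReduceLinear (p := p) hkk' f x := by
  induction x using IwasawaAlgebra.EisensteinCoeff.Twisted.induction_on with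
  | zero => rw [smul_zero, map_zero, smul_zero]
  | tmul c' a =>
    rw [IwasawaAlgebra.EisensteinCoeff.Twisted.smul_tmul, eisensteinTwistReduceLinear_tmul,
      eisensteinTwistReduceLinear_tmul, IwasawaAlgebra.EisensteinCoeff.Twisted.smul_tmul, map_mul]
  | add x y hx hy => rw [smul_add, map_add, hx, hy, map_add, smul_add]

/-- **The reduction map `M ⊗ A_{m,k'}(ψ) → M' ⊗ A_{m,k}(ψ)`** (`k ≤ k'`) along the change of rings
`A_{m,k'} ↠ A_{m,k}` and a morphism `f : M → M'` of discrete Galois modules, as a morphism of the twisted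
discrete Galois modules. For `M = E[p^{k'}] → M' = E[p^k]`, `P ↦ p^{k'-k} P`, this is the transition map
`T_𝔮/p^{k'} T_𝔮 → T_𝔮/p^k T_𝔮`; `H¹(K, T_𝔮) = lim_k H¹(K, T_𝔮/p^k T_𝔮)` is formed along
`galoisCohomology.map` of these maps. Equivariance: `σ` twists by `(1+T)^{κ(σ) mod p^J}` on both sides, the
levels `J = eisensteinLevel hm k'`, `eisensteinLevel hm k` being interchangeable (`pow_twistExponent_eq_of_pow_eq_one`).
[cite: Howard2004HeegnerKolyvagin, §2.2, Def. 2.2.3 and Lemma 2.2.7] [cite: MazurRubinMemoirs2004, §5.3] -/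
def eisensteinTwistReduce (f : ρ.toContRepresentation →ⁱL ρ'.toContRepresentation) :
    (κ.eisensteinTwist ρ hm k').toContRepresentation →ⁱL (κ.eisensteinTwist ρ' hm k).toContRepresentation where
  toContinuousLinearMap :=
    ⟨eisensteinTwistReduceLinear (p := p) hkk' f.toContinuousLinearMap.toLinearMap, continuous_of_discreteTopology⟩
  isIntertwining' σ := by
    ext x
    change eisensteinTwistReduceLinear (p := p) hkk' f.toContinuousLinearMap.toLinearMap
        (κ.eisensteinTwist ρ hm k' σ x) =
      κ.eisensteinTwist ρ' hm k σ
        (eisensteinTwistReduceLinear (p := p) hkk' f.toContinuousLinearMap.toLinearMap x)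
    induction x using IwasawaAlgebra.EisensteinCoeff.Twisted.induction_on with
    | zero => simp only [map_zero]
    | tmul c a =>
      have hk' : IwasawaAlgebra.EisensteinCoeff.onePlusT p m k ^ (p ^ eisensteinLevel (p := p) hm k') = 1 := by
        rw [← IwasawaAlgebra.EisensteinCoeff.reduce_onePlusT m hkk',
          ← RingHom.map_pow (IwasawaAlgebra.EisensteinCoeff.reduce p m hkk'),
          onePlusT_pow_prime_pow_eisensteinLevel, RingHom.map_one]
      rw [eisensteinTwist_apply_tmul, eisensteinTwistReduceLinear_tmul, eisensteinTwistReduceLinear_tmul,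
        eisensteinTwist_apply_tmul, RingHom.map_mul (IwasawaAlgebra.EisensteinCoeff.reduce p m hkk'),
        RingHom.map_pow (IwasawaAlgebra.EisensteinCoeff.reduce p m hkk'),
        IwasawaAlgebra.EisensteinCoeff.reduce_onePlusT, κ.pow_twistExponent_eq_of_pow_eq_one hk'
          (onePlusT_pow_prime_pow_eisensteinLevel (p := p) hm k) σ]
      congr 1
      exact congrArg (fun g ↦ g a) (f.isIntertwining' σ)
    | add x y hx hy => rw [map_add, map_add, hx, hy, map_add, map_add]

/-- Unfolding `eisensteinTwistReduce` on pure tensors: `c ⊗ a ↦ (c mod (q_m, p^k)) ⊗ f a`.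
[cite: Howard2004HeegnerKolyvagin, §2.2] -/
@[simp]
theorem eisensteinTwistReduce_tmul (f : ρ.toContRepresentation →ⁱL ρ'.toContRepresentation)
    (c : IwasawaAlgebra.EisensteinCoeff p m k') (a : M) :
    κ.eisensteinTwistReduce hm hkk' f (IwasawaAlgebra.EisensteinCoeff.Twisted.tmul c a) =
      IwasawaAlgebra.EisensteinCoeff.Twisted.tmul (IwasawaAlgebra.EisensteinCoeff.reduce p m hkk' c) (f a) :=
  eisensteinTwistReduceLinear_tmul hkk' _ c a

/-- `eisensteinTwistReduce` is semilinear along `A_{m,k'} ↠ A_{m,k}` (so on cohomology it is `Λ`-linear).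
[cite: Howard2004HeegnerKolyvagin, §2.2] -/
theorem eisensteinTwistReduce_smul (f : ρ.toContRepresentation →ⁱL ρ'.toContRepresentation)
    (c : IwasawaAlgebra.EisensteinCoeff p m k') (x : IwasawaAlgebra.EisensteinCoeff.Twisted p m k' M) :
    κ.eisensteinTwistReduce hm hkk' f (c • x) =
      IwasawaAlgebra.EisensteinCoeff.reduce p m hkk' c • κ.eisensteinTwistReduce hm hkk' f x :=
  eisensteinTwistReduceLinear_smul hkk' _ c x

/-- The reduction is `Λ`-linear: for `g ∈ Λ`, `r([g] • x) = [g] • r(x)`. [cite: Howard2004HeegnerKolyvagin, §2.2] -/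
theorem eisensteinTwistReduce_mk_smul (f : ρ.toContRepresentation →ⁱL ρ'.toContRepresentation)
    (g : IwasawaAlgebra p) (x : IwasawaAlgebra.EisensteinCoeff.Twisted p m k' M) :
    κ.eisensteinTwistReduce hm hkk' f ((Ideal.Quotient.mk _ g : IwasawaAlgebra.EisensteinCoeff p m k') • x) =
      (Ideal.Quotient.mk _ g : IwasawaAlgebra.EisensteinCoeff p m k) • κ.eisensteinTwistReduce hm hkk' f x := by
  rw [eisensteinTwistReduce_smul, IwasawaAlgebra.EisensteinCoeff.reduce_mk]

/-- The reduction is surjective when `f` is (e.g. `E[p^{k'}] → E[p^k]`, `P ↦ p^{k'-k} P`, over `K̄`).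
[cite: Howard2004HeegnerKolyvagin, §2.2] -/
theorem eisensteinTwistReduce_surjective (f : ρ.toContRepresentation →ⁱL ρ'.toContRepresentation)
    (hf : Function.Surjective f) : Function.Surjective (κ.eisensteinTwistReduce hm hkk' f) := by
  intro y
  induction y using IwasawaAlgebra.EisensteinCoeff.Twisted.induction_on with
  | zero => exact ⟨0, map_zero _⟩
  | tmul c a =>
    obtain ⟨c', rfl⟩ := IwasawaAlgebra.EisensteinCoeff.reduce_surjective m hkk' c
    obtain ⟨a', rfl⟩ := hf a
    exact ⟨IwasawaAlgebra.EisensteinCoeff.Twisted.tmul c' a', κ.eisensteinTwistReduce_tmul hm hkk' f c' a'⟩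
  | add x y hx hy =>
    obtain ⟨x', rfl⟩ := hx
    obtain ⟨y', rfl⟩ := hy
    exact ⟨x' + y', map_add _ _ _⟩

end ZpExtension

end Literature.NumberTheory.EllipticCurves

end
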